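import Mathlib
import Summits.PneNP.PneNP.Theorems.Nc03AvoidResidualCoreCandStarReductionSound

/-!
# Route Nc03AvoidResidualCore, item `CandStarReduction` (★) — the tangled-surplus solver, III: chains

Helper file for `stmt-PneNP-19963` (sequel of `…CandStarReductionSound`; cell pnp-ideate). The
structure replacing the memo's BFS forcing forest (ROUND-3-ADDENDUM-B Lemmas B.2/B.3):

* `par_injective` — two variables never share a parent output (the rule `w < u ∨ ¬apex w` is
  antisymmetric), so listed cherries are determined by their parent output (`cherries_unique`) and the
  successor map `pNext : par u ↦ ep u` follows them (`pNext_of_mem`);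
* `apex_lt` — **the apex index strictly increases along `pNext`**, hence chains make at most `N`
  moves (`le_apex_of_iterate`, `pNext_iterate_eq_none`) and STABILISE after `N` steps
  (`iterate_eq_of_le`); this is the acyclicity of the cherry graph, with no spanning trees;
* consequently the two outputs of a cherry have the same root and opposite colours (`chain_cherry`,
  needs `M ≥ N + 1` steps of fuel) and EVERY candidate separates every cherry (`consOK_all`).

Restricted-model (NC⁰₃) range-avoidance rung F-N1b of the PneNP frontier ladder (an algorithmic reduction between
two restricted AVOID problems); nothing here bears on P vs NP.
-/

set_option linter.dupNamespace false -- `Summit.PneNP.PneNP.…`: summit = sub-problem name (D-0017 single-conjunct layout)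

namespace Summit.PneNP.PneNP.Theorems.Nc03CandStarRF

open Finset Literature.Computability.Complexity
open Summit.PneNP.PneNP.Theorems.Nc03Reduction
  (PRaw ETrip enumT inSpan indic searchOut rawOf tripOf mem_enumT_iff mem_enumT rawOf_eq Vec ind bit chi
    vecL inSpan_iff bit_add)
open Summit.PneNP.PneNP.Theorems.Nc03AvoidResidualCoreCandCherry (tangled mem_tangled)

variable {N M : ℕ} (J : LocalMap 3 N M)

/-! ## The parent map is injective -/

/-- The other endpoint of a data endpoint, when both endpoints are named. -/
theorem othD_eq_of_ne {t : ℕ × ℕ × ℕ} {u u' : ℕ} (hu : isData t u = true) (hu' : isData t u' = true)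
    (hne : u ≠ u') : othD t u' = u := by
  simp only [isData, Bool.or_eq_true, decide_eq_true_eq] at hu hu'
  unfold othD
  split_ifs with h
  · rcases hu with hu | hu
    · exact absurd (hu.trans h.symm) hne
    · exact hu.symm
  · rcases hu' with hu' | hu'
    · exact absurd hu' h
    · rcases hu with hu | hu
      · exact hu.symm
      · exact absurd (hu.trans hu'.symm) hne

/-- Unpacking a witness. -/
theorem forceW_iff {u : ℕ} {e : ETrip} : forceW (rawOf J) u e = true ↔
    isData e.2 u = true ∧ apexB (rawOf J) e.2.1 u = true ∧
      (othD e.2 u < u ∨ apexB (rawOf J) e.2.1 (othD e.2 u) = false) := by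
  unfold forceW
  simp only [Bool.and_eq_true, Bool.or_eq_true, decide_eq_true_eq, Bool.not_eq_true', and_assoc]

/-- **Two variables never share a parent output** (the rule `w < u ∨ ¬apex w` is antisymmetric). -/
theorem par_injective {u u' : ℕ} {e : ETrip} (h : parOf (rawOf J) u = some e)
    (h' : parOf (rawOf J) u' = some e) : u = u' := by
  by_contra hne
  have hw := (forceW_iff J).1 (forceW_of_parOf J h)
  have hw' := (forceW_iff J).1 (forceW_of_parOf J h')
  obtain ⟨hd, ha, hr⟩ := hw
  obtain ⟨hd', ha', hr'⟩ := hw'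
  rw [othD_eq_of_ne hd' hd (Ne.symm hne)] at hr
  rw [othD_eq_of_ne hd hd' hne] at hr'
  rcases hr with hr | hr
  · rcases hr' with hr' | hr'
    · exact absurd (hr.trans hr') (lt_irrefl _)
    · rw [ha] at hr'; exact Bool.noConfusion hr'
  · rw [ha'] at hr; exact Bool.noConfusion hr

/-- Entries of a parent output are genuine outputs. -/
theorem parOf_eq_eOf {u : ℕ} {e : ETrip} (h : parOf (rawOf J) u = some e) : ∃ p : Fin M, e = eOf J p := by
  obtain ⟨p, rfl⟩ := (mem_enumT_iff J).1 (List.mem_of_find?_eq_some h)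
  exact ⟨p, rfl⟩

/-- Entries of an `epOf` output are genuine outputs. -/
theorem epOf_eq_eOf {u : ℕ} {e e' : ETrip} (h : epOf (rawOf J) u e = some e') : ∃ p : Fin M, e' = eOf J p := by
  obtain ⟨p, rfl⟩ := (mem_enumT_iff J).1 (List.mem_of_find?_eq_some h)
  exact ⟨p, rfl⟩

/-- Two enumerated outputs with the same index coincide. -/
theorem eOf_eq_of_fst_eq {p p' : Fin M} (h : (eOf J p).1 = (eOf J p').1) : p = p' := Fin.ext h

/-- **Listed cherries are determined by their parent output.** -/
theorem cherries_unique {q q' : ℕ × ETrip × ETrip} (hq : q ∈ cherries (rawOf J))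
    (hq' : q' ∈ cherries (rawOf J)) (h : q.2.1.1 = q'.2.1.1) : q = q' := by
  obtain ⟨u, -, hu⟩ := exists_of_mem_cherries hq
  obtain ⟨u', -, hu'⟩ := exists_of_mem_cherries hq'
  obtain ⟨-, hpar, -⟩ := cherryOf_eq_some hu
  obtain ⟨-, hpar', -⟩ := cherryOf_eq_some hu'
  obtain ⟨p, hp⟩ := parOf_eq_eOf J hpar
  obtain ⟨p', hp'⟩ := parOf_eq_eOf J hpar'
  have hpp : p = p' := eOf_eq_of_fst_eq J (by rw [← hp, ← hp', h])
  rw [hp] at hpar; rw [hp', ← hpp] at hpar'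
  have huu := par_injective J hpar hpar'
  rw [← huu, hu] at hu'
  exact Option.some_injective _ hu'

/-- The apex of a listed cherry is below `N`. -/
theorem fst_lt_of_mem_cherries {q : ℕ × ETrip × ETrip} (hq : q ∈ cherries (rawOf J)) : q.1 < N := by
  obtain ⟨u, hu, h⟩ := exists_of_mem_cherries hq
  obtain ⟨rfl, -⟩ := cherryOf_eq_some h
  exact hu

/-! ## The successor map -/

/-- `pNext` is `none` iff no cherry has the given parent output index. -/
theorem pNext_eq_none_iff (pr : PRaw) (o : ℕ) :
    pNext pr o = none ↔ ∀ q ∈ cherries pr, q.2.1.1 ≠ o := by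
  unfold pNext
  rw [Option.map_eq_none_iff, List.find?_eq_none]
  simp only [decide_eq_true_eq]

/-- A `some` of `pNext` comes from a cherry. -/
theorem exists_of_pNext_eq_some {pr : PRaw} {o o' : ℕ} (h : pNext pr o = some o') :
    ∃ q ∈ cherries pr, q.2.1.1 = o ∧ q.2.2.1 = o' := by
  unfold pNext at h
  obtain ⟨q, hq, rfl⟩ := Option.map_eq_some_iff.1 h
  have h1 := List.find?_some hq
  exact ⟨q, List.mem_of_find?_eq_some hq, by simpa using h1, rfl⟩

/-- **`pNext` follows listed cherries**: `par u ↦ ep u`. -/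
theorem pNext_of_mem {q : ℕ × ETrip × ETrip} (hq : q ∈ cherries (rawOf J)) :
    pNext (rawOf J) q.2.1.1 = some q.2.2.1 := by
  cases h : pNext (rawOf J) q.2.1.1 with
  | none => exact absurd rfl ((pNext_eq_none_iff _ _).1 h q hq)
  | some o' =>
    obtain ⟨q', hq', h1, h2⟩ := exists_of_pNext_eq_some h
    rw [cherries_unique J hq' hq h1] at h2
    rw [h2]

/-- **The apex index increases along the successor map.** -/
theorem apex_lt {q q' : ℕ × ETrip × ETrip} (hq : q ∈ cherries (rawOf J)) (hq' : q' ∈ cherries (rawOf J))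
    (h : q'.2.1.1 = q.2.2.1) : q.1 < q'.1 := by
  obtain ⟨u, -, hu⟩ := exists_of_mem_cherries hq
  obtain ⟨u', -, hu'⟩ := exists_of_mem_cherries hq'
  obtain ⟨hq1, hpar, hep⟩ := cherryOf_eq_some hu
  obtain ⟨hq1', hpar', -⟩ := cherryOf_eq_some hu'
  obtain ⟨p, hp⟩ := parOf_eq_eOf J hpar
  obtain ⟨p', hp'⟩ := epOf_eq_eOf J hep
  obtain ⟨p'', hp''⟩ := parOf_eq_eOf J hpar'
  have hpp : p'' = p' := eOf_eq_of_fst_eq J (by rw [← hp'', ← hp', h])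
  rw [hp] at hpar hep; rw [hp'] at hep; rw [hp'', hpp] at hpar'
  -- facts about `par u = p`, `ep u = p'`, `par u' = p'`
  obtain ⟨hd, ha, -⟩ := (forceW_iff J).1 (forceW_of_parOf J hpar)
  obtain ⟨hne, hhead, hd'⟩ := epOf_spec' J hep
  obtain ⟨hdu', -, hr'⟩ := (forceW_iff J).1 (forceW_of_parOf J hpar')
  have huu : u ≠ u' := by
    rintro rfl
    rw [hpar'] at hpar
    exact hne (congrArg Fin.val (eOf_eq_of_fst_eq J (congrArg Prod.fst (Option.some_injective _ hpar))))
  rw [othD_eq_of_ne hd' hdu' huu] at hr'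
  have hc : (eOf J p').2.1 = (eOf J p).2.1 := hhead
  rw [hq1, hq1']
  rcases hr' with hr' | hr'
  · exact hr'
  · rw [hc, ha] at hr'; exact Bool.noConfusion hr'

/-! ## Chains stabilise -/

/-- A chain step at a terminal output stays. -/
theorem chainStep_of_none {pr : PRaw} {s : ℕ × Bool} (h : pNext pr s.1 = none) : chainStep pr s = s := by
  unfold chainStep; rw [h]

/-- A chain step at a parent output moves and flips. -/
theorem chainStep_of_some {pr : PRaw} {s : ℕ × Bool} {o' : ℕ} (h : pNext pr s.1 = some o') :
    chainStep pr s = (o', !s.2) := by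
  unfold chainStep; rw [h]

/-- Chain steps commute with flipping the colour. -/
theorem chainStep_flip (pr : PRaw) (o : ℕ) (d : Bool) :
    chainStep pr (o, !d) = ((chainStep pr (o, d)).1, !(chainStep pr (o, d)).2) := by
  cases h : pNext pr o with
  | none =>
    rw [chainStep_of_none (s := (o, !d)) h, chainStep_of_none (s := (o, d)) h]
  | some o' =>
    rw [chainStep_of_some (s := (o, !d)) h, chainStep_of_some (s := (o, d)) h]

/-- Iterated chain steps commute with flipping the colour. -/
theorem iterate_flip (pr : PRaw) (k : ℕ) : ∀ (o : ℕ) (d : Bool),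
    (chainStep pr)^[k] (o, !d) = (((chainStep pr)^[k] (o, d)).1, !((chainStep pr)^[k] (o, d)).2) := by
  induction k with
  | zero => intro o d; rfl
  | succ k ih =>
    intro o d
    rw [Function.iterate_succ_apply, Function.iterate_succ_apply, chainStep_flip]
    have e : chainStep pr (o, d) = ((chainStep pr (o, d)).1, (chainStep pr (o, d)).2) := rfl
    conv_rhs => rw [e]
    exact ih _ _

/-- **Progress bound**: after `k` steps, a non-terminal position is the parent output of a cherry
whose apex is at least `k`. -/
theorem le_apex_of_iterate (o : ℕ) (d : Bool) : ∀ (k : ℕ) (q : ℕ × ETrip × ETrip),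
    q ∈ cherries (rawOf J) → q.2.1.1 = ((chainStep (rawOf J))^[k] (o, d)).1 → k ≤ q.1 := by
  intro k
  induction k with
  | zero => intro q _ _; exact Nat.zero_le _
  | succ k ih =>
    intro q hq hqk
    rw [Function.iterate_succ_apply'] at hqk
    cases h : pNext (rawOf J) ((chainStep (rawOf J))^[k] (o, d)).1 with
    | none =>
      rw [chainStep_of_none h] at hqk
      exact absurd hqk.symm ((pNext_eq_none_iff _ _).1 h q hq).symm
    | some o' =>
      rw [chainStep_of_some h] at hqk
      obtain ⟨q₀, hq₀, h₀, h₀'⟩ := exists_of_pNext_eq_some h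
      have hk := ih q₀ hq₀ h₀
      have hlt := apex_lt J hq₀ hq (by rw [hqk, h₀'])
      omega

/-- After `N` steps every chain is at a terminal output. -/
theorem pNext_iterate_eq_none (o : ℕ) (d : Bool) {k : ℕ} (hk : N ≤ k) :
    pNext (rawOf J) ((chainStep (rawOf J))^[k] (o, d)).1 = none := by
  rw [pNext_eq_none_iff]
  intro q hq hqk
  have h1 := le_apex_of_iterate J o d k q hq hqk
  have h2 := fst_lt_of_mem_cherries J hq
  omega

/-- Chains stabilise after `N` steps (offset form). -/
theorem iterate_add_eq (o : ℕ) (d : Bool) : ∀ j : ℕ,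
    (chainStep (rawOf J))^[N + j] (o, d) = (chainStep (rawOf J))^[N] (o, d)
  | 0 => rfl
  | j + 1 => by
    rw [Nat.add_succ, Function.iterate_succ_apply',
      chainStep_of_none (pNext_iterate_eq_none J o d (Nat.le_add_right N j)), iterate_add_eq o d j]

/-- **Chains stabilise after `N` steps.** -/
theorem iterate_eq_of_le (o : ℕ) (d : Bool) {k : ℕ} (hk : N ≤ k) :
    (chainStep (rawOf J))^[k] (o, d) = (chainStep (rawOf J))^[N] (o, d) := by
  obtain ⟨j, rfl⟩ := Nat.exists_eq_add_of_le hk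
  exact iterate_add_eq J o d j

/-- A chain from a terminal output never moves. -/
theorem iterate_of_none {pr : PRaw} {o : ℕ} (h : pNext pr o = none) (d : Bool) (k : ℕ) :
    (chainStep pr)^[k] (o, d) = (o, d) := by
  induction k with
  | zero => rfl
  | succ k ih => rw [Function.iterate_succ_apply, chainStep_of_none (s := (o, d)) h, ih]

/-- **Root and colour along a cherry**: the two outputs of a cherry have the same root and opposite
colours (when `M ≥ N + 1`). -/
theorem chain_cherry (hNM : N + 1 ≤ M) {q : ℕ × ETrip × ETrip} (hq : q ∈ cherries (rawOf J)) :
    (chain (rawOf J) q.2.1.1).1 = (chain (rawOf J) q.2.2.1).1 ∧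
      (chain (rawOf J) q.2.1.1).2 = !(chain (rawOf J) q.2.2.1).2 := by
  have hM : (rawOf J).2.1 = M := rfl
  unfold chain
  rw [hM]
  obtain ⟨M', rfl⟩ : ∃ M', M = M' + 1 := ⟨M - 1, by omega⟩
  rw [Function.iterate_succ_apply, chainStep_of_some (s := (q.2.1.1, false)) (pNext_of_mem J hq)]
  simp only [Bool.not_false]
  rw [show (true : Bool) = !false from rfl, iterate_flip, iterate_eq_of_le J _ _ (show N ≤ M' by omega),
    iterate_eq_of_le J _ _ (show N ≤ M' + 1 by omega)]
  exact ⟨rfl, rfl⟩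

/-- The root of a terminal output is itself, with colour `false`. -/
theorem chain_of_none {pr : PRaw} {o : ℕ} (h : pNext pr o = none) : chain pr o = (o, false) :=
  iterate_of_none h false _

/-! ## Every candidate separates every cherry -/

/-- Tangledness from a sharing witness. -/
theorem tangB_of_shared {p p' : Fin M} (hne : p' ≠ p) (hhead : (J.vars p' 0).val = (J.vars p 0).val)
    {u : ℕ} (hu : isData (tripOf J p) u = true) (hu' : isData (tripOf J p') u = true) :
    tangB (rawOf J) (eOf J p) = true := by
  unfold tangB
  rw [List.any_eq_true]
  refine ⟨eOf J p', mem_enumT J p', ?_⟩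
  simp only [Bool.and_eq_true, Bool.not_eq_true', decide_eq_false_iff_not, decide_eq_true_eq,
    Bool.or_eq_true]
  refine ⟨⟨fun h => hne (Fin.ext h), hhead⟩, ?_⟩
  rcases (isData_iff J p u).1 hu with h | h
  · left; rw [← h] at hu'; exact hu'
  · right; rw [← h] at hu'; exact hu'

/-- An output having a forced datum is covered once tangled. -/
theorem covB_of {p : Fin M} (ht : tangB (rawOf J) (eOf J p) = true) {u : ℕ}
    (hu : isData (tripOf J p) u = true) (hf : forcedB (rawOf J) u = true) : covB (rawOf J) (eOf J p) = true := by
  unfold covB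
  rw [ht, Bool.true_and, Bool.or_eq_true]
  rcases (isData_iff J p u).1 hu with h | h
  · left; show forcedB (rawOf J) (J.vars p 1).val = true; rw [h]; exact hf
  · right; show forcedB (rawOf J) (J.vars p 2).val = true; rw [h]; exact hf

/-- **Every candidate separates every listed cherry** (when `M ≥ N + 1`). -/
theorem consOK_all (hNM : N + 1 ≤ M) (k : ℕ) : consOK (rawOf J) k = true := by
  unfold consOK
  rw [List.all_eq_true]
  intro q hq
  obtain ⟨u, -, hu⟩ := exists_of_mem_cherries hq
  obtain ⟨hq1, hpar, hep⟩ := cherryOf_eq_some hu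
  obtain ⟨p, hp⟩ := parOf_eq_eOf J hpar
  obtain ⟨p', hp'⟩ := epOf_eq_eOf J hep
  have hforced : forcedB (rawOf J) u = true := by
    unfold forcedB; rw [hpar]; rfl
  rw [hp] at hpar hep; rw [hp'] at hep
  obtain ⟨hd, -, -⟩ := (forceW_iff J).1 (forceW_of_parOf J hpar)
  obtain ⟨hne, hhead, hd'⟩ := epOf_spec' J hep
  have ht : tangB (rawOf J) (eOf J p) = true := tangB_of_shared J (fun h => hne (congrArg Fin.val h)) hhead hd hd'
  have ht' : tangB (rawOf J) (eOf J p') = true :=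
    tangB_of_shared J (fun h => hne (congrArg Fin.val h).symm) hhead.symm hd' hd
  have hc : covB (rawOf J) (eOf J p) = true := covB_of J ht hd hforced
  have hc' : covB (rawOf J) (eOf J p') = true := covB_of J ht' hd' hforced
  obtain ⟨hroot, hcol⟩ := chain_cherry J hNM hq
  rw [hp, hp'] at hroot hcol
  have hflip : flipB (rawOf J) k (eOf J p).1 = flipB (rawOf J) k (eOf J p').1 := by
    unfold flipB; rw [hroot]
  rw [hp, hp']
  unfold yB
  rw [hc, hc', hcol, hflip, Bool.true_and, Bool.true_and]
  cases (chain (rawOf J) (eOf J p').1).2 <;> cases flipB (rawOf J) k (eOf J p').1 <;> rfl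

end Summit.PneNP.PneNP.Theorems.Nc03CandStarRF
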